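import Mathlib
import HarnessLib
import Summits.RiemannHypothesis.RiemannHypothesis.Theorems.IntegerScrewRungCertFused

/-!
# Route `IntegerScrew` — kernel certificate checker: the FUSED column-charge test with VARIABLE chunk boundaries

The fused column-charge form of the domination test (`IntegerScrewRungCertFused`, sos-eng-1 gen8) decides chunks of a CONSTANT number `c` of
rows (`zrowW_of_fusedD`).  Measured on the `S_512` data (screw-kernel-1 g0, 2026-08-26): a chunk `[i₀, i₁)` costs ≈ `3 + 9·10⁻⁵·i₁²/2` s of kernel
for decoding the packed factor rows `≤ i₁` plus ≈ `8·10⁻³·i` s per row `i` — so under the per-decide work cap the late rows fit 2–3 per chunk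
while the early rows fit 70; a constant `c` is dictated by the last chunk.  This module lets the chunk boundaries vary:
* `fusedFinalV N bnd idx outs` — the light final test for boundaries `bnd = [b₀ = 0, b₁, …, b_K = N]` (chunk `k` = rows `b_k ≤ i < b_{k+1}`)
  with a row index `idx[m] = (k, t)` (`b_k + t = m`, `t < b_{k+1} − b_k`, both CHECKED by the test, so `idx` is untrusted data);
* `sum_range_chunksV` — re-indexing a sum over `range b_K` by consecutive variable chunks;
* ★ `zrowW_of_fusedDV` — the chunk equations `fusedChunkKPD … (b_k) (b_{k+1} − b_k) = outs[k]`, `fusedFinalV … = true` and the shape facts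
  ⇒ every indexed row test `zrowW N utab Lz lamZ i` (consumed unchanged by `posDef_of_rungW_mem` / `quadForm_ge_of_rungW_mem`).
Nothing here bears on the truth of RH (every rung is an RH-consequence made unconditional by computation).  Refs: S. M. Rump, Acta Numerica 19
(2010) §10.8 [folklore]; M. Suzuki, J. Lond. Math. Soc. (2) 108 (2023), (1.1) [Suzuki2023].
-/

set_option linter.dupNamespace false
set_option autoImplicit false

namespace Summit.RiemannHypothesis.RiemannHypothesis.Theorems.IntegerScrew.RungCert

open Literature.NumberTheory.LFunctions Literature.Analysis.ValidatedNumerics Finset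
open Literature.Analysis.ValidatedNumerics.Numerics Literature.Analysis.ValidatedNumerics.KroneckerDot
open scoped BigOperators

/-- **The final (light) test with variable chunk boundaries** `bnd = [b₀, …, b_K]`: for every `m < N`, with `(k, t) = idx[m]`:
`b_k + t = m`, `t < b_{k+1} − b_k`, and the total column charge at `m` is at most credit `t` of chunk `k`. [folklore] -/
def fusedFinalV (N : ℕ) (bnd : List ℕ) (idx : List (ℕ × ℕ)) (outs : List (List ℤ × List ℤ)) : Bool :=
  let S := colSums outs
  rall N fun m =>
    let kt := idx.getD m (0, 0)
    decide (bnd.getD kt.1 0 + kt.2 = m) && decide (kt.2 < bnd.getD (kt.1 + 1) 0 - bnd.getD kt.1 0) &&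
      decide (S.getD m 0 ≤ ((outs.getD kt.1 ([], [])).1).getD kt.2 0)

/-- Re-indexing a sum over `range (b K)` by consecutive variable chunks `[b k, b (k+1))` (`b 0 = 0`, `b` monotone up to `K`). [folklore] -/
theorem sum_range_chunksV (f : ℕ → ℤ) (b : ℕ → ℕ) (h0 : b 0 = 0) :
    ∀ K : ℕ, (∀ k < K, b k ≤ b (k + 1)) →
      ∑ k ∈ range K, ∑ t ∈ range (b (k + 1) - b k), f (b k + t) = ∑ j ∈ range (b K), f j
  | 0, _ => by simp [h0]
  | K + 1, hmono => by
      rw [Finset.sum_range_succ, sum_range_chunksV f b h0 K (fun k hk => hmono k (by omega))]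
      have hK : b K ≤ b (K + 1) := hmono K (by omega)
      have e : b (K + 1) = b K + (b (K + 1) - b K) := by omega
      conv_rhs => rw [e, Finset.sum_range_add]

section specV
variable {N : ℕ} {utab : List (List FI)} {lamZ : ℤ} {W Mx : ℕ}

/-- ★ **FUSED chunks with VARIABLE boundaries decide every row**: boundaries `bnd` of length `K + 1` with `bnd[0] = 0`, `bnd[K] = N`,
monotone; each chunk's output equal to `outs[k]`; the light final test `fusedFinalV` passed ⇒ every indexed row test holds
(for `Lz = unpackRowsZ B O lzP 0`; first column supplied as a literal `D = dcol utab`). [folklore] -/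
theorem zrowW_of_fusedDV {B O K : ℕ} {bnd : List ℕ} {idx : List (ℕ × ℕ)} {lzP : List ℕ} {outs : List (List ℤ × List ℤ)}
    {D : List FI}
    (hlen : utab.length = N + 2) (hN : 1 ≤ N)
    (hbl : bnd.length = K + 1) (hb0 : bnd.getD 0 0 = 0) (hbK : bnd.getD K 0 = N)
    (hmono : ∀ k < K, bnd.getD k 0 ≤ bnd.getD (k + 1) 0)
    (hlz : lzOK (RungCert.unpackRowsZ B O lzP 0) N = true)
    (hab : absBoundOK Mx (RungCert.unpackRowsZ B O lzP 0) = true) (hcap : N * Mx * Mx < W)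
    (hLz : lzP.length = N) (houts : outs.length = K) (hD : D = dcol utab)
    (hch : ∀ k < K, fusedChunkKPD N utab D lzP lamZ B O W (bnd.getD k 0) (bnd.getD (k + 1) 0 - bnd.getD k 0) =
      outs.getD k ([], []))
    (hfin : fusedFinalV N bnd idx outs = true) :
    ∀ i < N, zrowW N utab (RungCert.unpackRowsZ B O lzP 0) lamZ i = true := by
  subst hD
  set Lz := RungCert.unpackRowsZ B O lzP 0 with hLzdef
  have hLzlen : Lz.length = N := by rw [hLzdef, length_unpackRowsZ, hLz]
  -- the boundaries are monotone all the way, hence at most `N`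
  have hmle : ∀ d k, k + d ≤ K → bnd.getD k 0 ≤ bnd.getD (k + d) 0 := by
    intro d
    induction d with
    | zero => intro k _; simp
    | succ d ih =>
        intro k hk
        have h1 := ih k (by omega)
        have h2 := hmono (k + d) (by omega)
        rw [Nat.add_assoc] at h2
        exact h1.trans h2
  have hle : ∀ k ≤ K, bnd.getD k 0 ≤ N := fun k hk => by
    have := hmle (K - k) k (by omega)
    rwa [show k + (K - k) = K by omega, hbK] at this
  -- the spec of every chunk
  have hspec : ∀ k < K,
      (outs.getD k ([], [])).1 =
        (List.range (bnd.getD (k + 1) 0 - bnd.getD k 0)).map (fun t => creditZ N utab Lz lamZ (bnd.getD k 0 + t)) ∧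
      ∀ m, (outs.getD k ([], [])).2.getD m 0 =
        ∑ t ∈ range (bnd.getD (k + 1) 0 - bnd.getD k 0),
          (if m < bnd.getD k 0 + t then chargeZ N utab Lz lamZ (bnd.getD k 0 + t) m else 0) := by
    intro k hk
    rw [← hch k hk]
    unfold fusedChunkKPD
    rw [ksPacked_eq lzP 0 (by simp [hLz])]
    have hkc : bnd.getD k 0 + (bnd.getD (k + 1) 0 - bnd.getD k 0) ≤ N := by
      have h1 := hmono k hk
      have h2 := hle (k + 1) (by omega)
      omega
    obtain ⟨k1, _, k3⟩ := fRows_spec (lamZ := lamZ) hlen hN hlz hab hcap hLzlen (bnd.getD (k + 1) 0 - bnd.getD k 0)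
      (bnd.getD k 0) (List.replicate N 0) [] hkc (by simp)
    refine ⟨by simpa using k1, fun m => ?_⟩
    rw [k3 m]
    simp
  intro i hi
  -- the row index entry of `i`, validated by the final test
  have hrow := of_rall hfin (k := i) hi
  simp only [Bool.and_eq_true, decide_eq_true_eq] at hrow
  obtain ⟨⟨hkt1, hkt2⟩, hkt3⟩ := hrow
  set k := (idx.getD i (0, 0)).1 with hkdef
  set t := (idx.getD i (0, 0)).2 with htdef
  have hkK : k < K := by
    by_contra hc
    have h0 : bnd.getD (k + 1) 0 = 0 := List.getD_eq_default _ _ (by rw [hbl]; omega)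
    rw [h0] at hkt2
    omega
  -- credit of `i` from its chunk
  have hcred : ((outs.getD k ([], [])).1).getD t 0 = creditZ N utab Lz lamZ i := by
    rw [(hspec k hkK).1, List.getD_eq_getElem?_getD, List.getElem?_map, List.getElem?_range hkt2]
    simp only [Option.map_some, Option.getD_some, hkt1]
  -- the column charges at `i` summed over chunks = Σ_{j > i} charge_j(i)
  have hsum : sumP outs i = ∑ j ∈ range N, (if i < j then chargeZ N utab Lz lamZ j i else 0) := by
    unfold sumP
    rw [sum_map_eq_sum_range_getD _ ([], []), houts]
    rw [Finset.sum_congr rfl (fun k hk => (hspec k (mem_range.1 hk)).2 i)]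
    have h := sum_range_chunksV (fun j => if i < j then chargeZ N utab Lz lamZ j i else 0)
      (fun k => bnd.getD k 0) hb0 K hmono
    rw [hbK] at h
    exact h
  -- the final test at `i`
  have hfin' : sumP outs i ≤ ((outs.getD k ([], [])).1).getD t 0 := by
    rw [← getD_colSums]
    exact hkt3
  rw [hcred, hsum] at hfin'
  exact zrowW_of_credit hlen hi hfin'

end specV

end Summit.RiemannHypothesis.RiemannHypothesis.Theorems.IntegerScrew.RungCert
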